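import Literature.Computability.AlgebraicComplexity.GMQ16Lemma43Holds
import Literature.Computability.AlgebraicComplexity.Bur24PowerSubstitution
import Literature.Computability.AlgebraicComplexity.PBoundedGrowth
import HarnessLib

/-!
# GMQ16 Question 4.4(4) "`VP* = \overline{VP}`?" — the degree bound of `\overline{VP}` (typing correction)

Grochow–Mulmuley–Qiao, *Boundaries of VP and VNP* (ICALP 2016, arXiv:1605.02815). §1 (held text
`paper:arxiv-1605.02815`, p0003 L13–L16): "`\overline{VP}` is the class of families of polynomials that are
**of polynomial degree** and can be approximated infinitesimally closely by arithmetic circuits of polynomial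
size"; likewise Bürgisser's 2024 survey, Def. 4.23 (held text `paper:arxiv-2406.06217`, p0021 L97–L100):
"`\bVP` … sequences `(f_n)` such that `deg f_n` AND `\bL(f_n)` are polynomially bounded".

The tree's class predicate `IsVPBarFamily f := IsPBounded (fun n => approxComplexity (f n))`
(`BLMW11KroneckerApproximation.lean`, BLMW 2011 Def. 9.3.1) carries NO degree bound (see the remark
"degree bound aside" at `isVPBarFamily_iff_isPBounded_borderComplexity`, `BorderComplexityAlder.lean`), so a
statement about `\overline{VP}` must add the p-family clause `IsPFamily f`.  The neutral rendering
`GMQ2016.question_4_4_4` of Question 4.4(4) in `GMQ16PDefinableDegenerations.lean`,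

  `∀ v f, IsPBounded v → IsVPBarFamily f → IsVPStarFamily f`,

omits it and is therefore FALSE for a trivial reason unrelated to the printed question: the one-variable family
`x^{2^n}` has `\underline{L} ≤ L ≤ n` (repeated squaring, tree `complexity_X_pow_two_pow_le`) but degree `2^n`,
while every `VP*` family has p-bounded degree (`deg f_n ≤ deg g_n`, tree `totalDegree_le_of_isLimit`).

This file records
* `isPBounded_totalDegree_of_isVPStarFamily` — `VP*` families have p-bounded degree [GMQ16 §3.3];
* `not_question_4_4_4` — the refutation of the degree-free rendering (a typing artefact, NOT an answer to
  the printed question);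
* `question_4_4_4_pFamily` — the faithful rendering "`\overline{VP} ⊆ VP*` on p-families", typed neutrally,
  never asserted [GMQ16 Question 4.4(4)];
* `closureVP_subset_vnp_of_thm_1a_star_of_question_4_4_4_pFamily` — the GMQ16 programme in one line: an
  affirmative answer together with Thm 1(a) (`VNP* ⊆ VNP`, named fact `thm_1a_star`) gives
  `\overline{VP} ⊆ VNP` on p-families (the inclusion "not even known" on p.3 L21) [GMQ16 §1, Cor. 4.2].
-/

noncomputable section

open MvPolynomial

namespace Literature.Computability.AlgebraicComplexity.GMQ2016

/-- `VP*` families have p-bounded degree: a degeneration `f = lim g(y(t))` has `deg f ≤ deg g`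
(`totalDegree_le_of_isLimit`) and `g ∈ VP` is a p-family. [cite: GrochowMulmuleyQiao2016, §3.3] -/
theorem isPBounded_totalDegree_of_isVPStarFamily {v : ℕ → ℕ} {f : ∀ n, MvPolynomial (Fin (v n)) ℂ}
    (hf : IsVPStarFamily f) : IsPBounded fun n => (f n).totalDegree := by
  obtain ⟨l, g, hg, -, -, K, s, -, -, hdeg⟩ := hf
  refine hg.1.2.mono fun n => ?_
  obtain ⟨a, -, -, hlim⟩ := hdeg n
  exact totalDegree_le_of_isLimit (g n) (f n) a hlim

/-- `VP*` families are p-families. [cite: GrochowMulmuleyQiao2016, §3.3] -/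
theorem isPFamily_of_isVPStarFamily {v : ℕ → ℕ} {f : ∀ n, MvPolynomial (Fin (v n)) ℂ}
    (hf : IsVPStarFamily f) : IsPFamily f := by
  refine ⟨?_, isPBounded_totalDegree_of_isVPStarFamily hf⟩
  obtain ⟨l, g, -, -, hv, -⟩ := hf
  exact hv.mono fun n => by simp

/-- **The degree-free rendering `question_4_4_4` is refutable** (typing artefact: `IsVPBarFamily` has no degree
bound): `f_n = x^{2^n}` in one variable has `\underline{L}(f_n) ≤ L(f_n) ≤ n` but `deg f_n = 2^n`, so
`(f_n) ∉ VP*`.  This does NOT bear on the printed Question 4.4(4), whose `\overline{VP}` consists of families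
of polynomial degree — see `question_4_4_4_pFamily`. [cite: GrochowMulmuleyQiao2016, Question 4.4(4) and §1 (p.3 L13–L16)] [cite: Burgisser2024Completeness, Def. 4.23 and §4.2] -/
theorem not_question_4_4_4 : ¬ question_4_4_4 := by
  intro H
  set f : ∀ n, MvPolynomial (Fin ((fun _ : ℕ => 1) n)) ℂ := fun n => (X 0 : MvPolynomial (Fin 1) ℂ) ^ 2 ^ n
    with hf
  have hv : IsPBounded (fun _ : ℕ => 1) := IsPBounded.const 1
  have hbar : IsVPBarFamily f := by
    refine ⟨1, fun n => ?_⟩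
    calc approxComplexity (f n) ≤ complexity (f n) := approxComplexity_le_complexity (f n)
      _ ≤ n := complexity_X_pow_two_pow_le (k := ℂ) (0 : Fin 1) n
      _ ≤ n ^ 1 + 1 := by simp
  have hdeg := isPBounded_totalDegree_of_isVPStarFamily (H _ f hv hbar)
  refine not_isPBounded_two_pow (hdeg.mono fun n => ?_)
  show 2 ^ n ≤ (f n).totalDegree
  rw [hf]
  simp [totalDegree_X_pow]

/-- **GMQ16 Question 4.4(4), faithful rendering — OPEN QUESTION, typed neutrally, never asserted:** "Is
`VP* = \overline{VP}`?" — the content is `\overline{VP} ⊆ VP*` for p-FAMILIES (p-bounded number of variables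
AND degree) with p-bounded border complexity. [cite: GrochowMulmuleyQiao2016, Question 4.4(4)] [status: open question of the source] -/
def question_4_4_4_pFamily : Prop :=
  ∀ (v : ℕ → ℕ) (f : ∀ n, MvPolynomial (Fin (v n)) ℂ), IsPFamily f → IsVPBarFamily f → IsVPStarFamily f

/-- The degree-free rendering implies the faithful one (so nothing proved FROM `question_4_4_4` as a hypothesis is
lost by switching). [cite: GrochowMulmuleyQiao2016, Question 4.4(4)] -/
theorem question_4_4_4_pFamily_of_question_4_4_4 (h : question_4_4_4) : question_4_4_4_pFamily :=
  fun v f hpf hbar => h v f (hpf.1.mono fun n => by simp) hbar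

/-- **The GMQ16 programme in one line**: `VNP* ⊆ VNP` (Thm 1(a), named fact) and an affirmative answer to
Question 4.4(4) give `\overline{VP} ⊆ VNP` on p-families — the inclusion the source calls "not even known"
(p.3 L21). [cite: GrochowMulmuleyQiao2016, §1 (p.3 L21), Thm. 1(a), Cor. 4.2, Question 4.4(4)] -/
theorem closureVP_subset_vnp_of_thm_1a_star_of_question_4_4_4_pFamily (h1 : thm_1a_star)
    (h4 : question_4_4_4_pFamily) :
    ∀ (v : ℕ → ℕ) (f : ∀ n, MvPolynomial (Fin (v n)) ℂ), IsPFamily f → IsVPBarFamily f → IsVNPFamily f :=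
  fun v f hpf hbar => cor_4_2_of_thm_1a_star h1 v f (h4 v f hpf hbar)

end Literature.Computability.AlgebraicComplexity.GMQ2016

end
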